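import Mathlib
import Summits.MatrixMultiplication.MatrixMultiplication.Theses.MatrixPointInterpolation

/-!
# Crux-ideate (round 1, ideator 2) sketch for `MatrixPointInterpolation.LongMasquerade`
# (stmt-MatrixMultiplication-18938): typed FIRST LEMMAS of the idea cards

* `StateCubature` card (`one-node-cubature`): `window_of_stateWindow` (the one-node cubature lemma),
  `StateLongMasquerade` (the transferred crux C⁺) and `longMasquerade_of_state` (C⁺ → crux).
* `SupportAutomata` card (`support-avoidance-automata`): `IdSupport` (support of the identities),
  `idSupport_mul_left/right` (monoid-ideal property), `win_of_support_vanishing` (word-by-word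
  vanishing on the support gives the window), `MonomialMasquerade` (the finite search target) and
  `longMasquerade_of_monomial`.

ALL PROVED (rc 0, no `sorry`): in particular the one-node cubature lemma `window_of_stateWindow`,
`longMasquerade_of_state : StateLongMasquerade → LongMasquerade` and
`longMasquerade_of_monomial : (∃ k ≥ 2, ∀ n₀, ∃ n d, n₀ ≤ n ∧ MonomialMasquerade k n d) → LongMasquerade`
are kernel-checked reductions of the crux to the two cards' targets; every constant is an existing
Mathlib / route declaration.
-/

namespace Summit.MatrixMultiplication.MatrixMultiplication.Cruxes.LongMasquerade.Ideate2

open scoped BigOperators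
open Matrix

open Summit.MatrixMultiplication.MatrixMultiplication.Theses.MatrixPointInterpolation (LongMasquerade)

/-- `Win k D A`: every two-letter identity of `M_k(ℂ)` of degree `≤ D` vanishes at the pair `A`. -/
def Win (k D : ℕ) {n : ℕ} (A : Fin 2 → Matrix (Fin n) (Fin n) ℂ) : Prop :=
  ∀ (T : Finset (List (Fin 2))) (c : List (Fin 2) → ℂ), (∀ w ∈ T, w.length ≤ D) →
    (∀ B : Fin 2 → Matrix (Fin k) (Fin k) ℂ, (∑ w ∈ T, c w • (w.map B).prod) = 0) →
    (∑ w ∈ T, c w • (w.map A).prod) = 0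

/-- `Gen d A`: words of length `≤ d` in the pair `A` span `M_n`. -/
def Gen (d : ℕ) {n : ℕ} (A : Fin 2 → Matrix (Fin n) (Fin n) ℂ) : Prop :=
  Submodule.span ℂ {M : Matrix (Fin n) (Fin n) ℂ |
    ∃ w : List (Fin 2), w.length ≤ d ∧ (w.map A).prod = M} = ⊤

/-- `StateWin k D ρ A`: the STATE `X ↦ tr (ρ X)` kills every identity of `M_k` of degree `≤ D`
evaluated at `A` ("`(A, ρ)` is a one-node signed cubature rule of degree `D` for `k×k` evaluations"). -/
def StateWin (k D : ℕ) {n : ℕ} (ρ : Matrix (Fin n) (Fin n) ℂ) (A : Fin 2 → Matrix (Fin n) (Fin n) ℂ) :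
    Prop :=
  ∀ (T : Finset (List (Fin 2))) (c : List (Fin 2) → ℂ), (∀ w ∈ T, w.length ≤ D) →
    (∀ B : Fin 2 → Matrix (Fin k) (Fin k) ℂ, (∑ w ∈ T, c w • (w.map B).prod) = 0) →
    Matrix.trace (ρ * ∑ w ∈ T, c w • (w.map A).prod) = 0

/-- FIRST LEMMA of the `one-node-cubature` card (the one-node cubature / state sandwich):
generation in degree `d` plus an INVERTIBLE state exact on identities of degree `≤ 3d` gives the
window `2d`.  Proof sketch: for `f ∈ (I_k)_{≤2d}` and `|u| ≤ d`, `u·f ∈ (I_k)_{≤3d}`, so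
`tr (ρ u(A) f(A)) = 0`; the matrices `ρ u(A)` span `M_n` (`Gen d`, `ρ` invertible), hence `f(A) = 0`. -/
theorem window_of_stateWindow {n k d : ℕ} (A : Fin 2 → Matrix (Fin n) (Fin n) ℂ)
    (ρ : Matrix (Fin n) (Fin n) ℂ) (hρ : IsUnit ρ) (hgen : Gen d A) (hstate : StateWin k (3 * d) ρ A) :
    Win k (2 * d) A := by
  classical
  intro T c hT hB
  set F := ∑ w ∈ T, c w • (w.map A).prod with hF
  -- step 1: the state kills `u(A) * F` for every word `u` of length `≤ d` (apply `hstate` to `u • T`)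
  have step1 : ∀ u : List (Fin 2), u.length ≤ d →
      Matrix.trace (ρ * ((u.map A).prod * F)) = 0 := by
    intro u hu
    have hinj : Set.InjOn (fun w : List (Fin 2) => u ++ w) (T : Set (List (Fin 2))) :=
      fun x _ y _ h => List.append_cancel_left h
    have key := hstate (T.image fun w => u ++ w) (fun v => c (v.drop u.length)) ?_ ?_
    · rw [Finset.sum_image hinj] at key
      simp only [List.drop_left, List.map_append, List.prod_append] at key
      have hrw : (u.map A).prod * F = ∑ x ∈ T, c x • ((u.map A).prod * (x.map A).prod) := by
        rw [hF, Finset.mul_sum]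
        exact Finset.sum_congr rfl fun x _ => by rw [Matrix.mul_smul]
      rw [hrw]
      exact key
    · intro v hv
      obtain ⟨w, hw, rfl⟩ := Finset.mem_image.1 hv
      simp only [List.length_append]
      have := hT w hw
      omega
    · intro B
      rw [Finset.sum_image hinj]
      simp only [List.drop_left, List.map_append, List.prod_append]
      calc ∑ x ∈ T, c x • ((u.map B).prod * (x.map B).prod)
          = (u.map B).prod * ∑ x ∈ T, c x • (x.map B).prod := by
            rw [Finset.mul_sum]
            exact Finset.sum_congr rfl fun x _ => by rw [Matrix.mul_smul]
        _ = 0 := by rw [hB B, Matrix.mul_zero]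
  -- step 2: by linearity over the span (= ⊤, `Gen d A`) the state kills `Y * F` for every `Y`
  have step2 : ∀ Y : Matrix (Fin n) (Fin n) ℂ, Matrix.trace (ρ * (Y * F)) = 0 := by
    intro Y
    have hY : Y ∈ Submodule.span ℂ {M : Matrix (Fin n) (Fin n) ℂ |
        ∃ w : List (Fin 2), w.length ≤ d ∧ (w.map A).prod = M} := by
      rw [Gen] at hgen
      rw [hgen]
      exact Submodule.mem_top
    refine Submodule.span_induction ?_ ?_ ?_ ?_ hY
    · rintro M ⟨w, hw, rfl⟩
      exact step1 w hw
    · simp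
    · intro x y _ _ hx hy
      rw [Matrix.add_mul, Matrix.mul_add, Matrix.trace_add, hx, hy, add_zero]
    · intro a x _ hx
      rw [Matrix.smul_mul, Matrix.mul_smul, Matrix.trace_smul, hx, smul_zero]
  -- step 3: `ρ` is invertible, so `trace (X * F) = 0` for every `X`, hence `F = 0`
  obtain ⟨uρ, huρ⟩ := hρ
  have step3 : ∀ X : Matrix (Fin n) (Fin n) ℂ, Matrix.trace (X * F) = 0 := by
    intro X
    have h := step2 ((↑uρ⁻¹ : Matrix (Fin n) (Fin n) ℂ) * X)
    rw [← Matrix.mul_assoc, ← Matrix.mul_assoc, ← huρ, Units.mul_inv, Matrix.one_mul] at h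
    exact h
  have hzero : F = 0 := by
    rw [Matrix.ext_iff_trace_mul_left]
    intro x
    rw [step3 x, Matrix.mul_zero, Matrix.trace_zero]
  exact hzero

/-- The converse direction (trivial): the window kills every state up to the same degree. -/
theorem stateWindow_of_window {n k D : ℕ} (A : Fin 2 → Matrix (Fin n) (Fin n) ℂ)
    (ρ : Matrix (Fin n) (Fin n) ℂ) (h : Win k D A) : StateWin k D ρ A := by
  intro T c hT hB
  rw [h T c hT hB, Matrix.mul_zero, Matrix.trace_zero]

/-- The TRANSFERRED crux C⁺ (`Transfer:` field of the card): long STATE masquerades — for some fixed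
`k ≥ 2` and every `n₀` there are `n ≥ n₀`, `d`, a pair `A` generating `M_n` in degree `d` and an
invertible weight `ρ` whose state is exact on the identities of `M_k` up to degree `3d`. -/
def StateLongMasquerade : Prop :=
  ∃ k : ℕ, 2 ≤ k ∧ ∀ n₀ : ℕ, ∃ (n d : ℕ) (A : Fin 2 → Matrix (Fin n) (Fin n) ℂ)
    (ρ : Matrix (Fin n) (Fin n) ℂ), n₀ ≤ n ∧ IsUnit ρ ∧ Gen d A ∧ StateWin k (3 * d) ρ A

/-- C⁺ → crux (three lines from `window_of_stateWindow`; `Win k (2*d) A` is literally the route's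
window clause and `Gen d A` its span clause). -/
theorem longMasquerade_of_state (h : StateLongMasquerade) : LongMasquerade := by
  obtain ⟨k, hk, hfam⟩ := h
  refine ⟨k, hk, fun n₀ => ?_⟩
  obtain ⟨n, d, A, ρ, hn, hρ, hgen, hstate⟩ := hfam n₀
  exact ⟨n, d, A, hn, hgen, window_of_stateWindow A ρ hρ hgen hstate⟩

/-! ### Support-avoidance automata -/

/-- `IdSupport k D`: the set of two-letter words of length `≤ D` that occur with a nonzero
coefficient in SOME identity of `M_k(ℂ)` supported on words of length `≤ D` (basis-independent:
the complement is the set of common zero coordinates of the identity space). -/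
def IdSupport (k D : ℕ) : Set (List (Fin 2)) :=
  {w | ∃ (T : Finset (List (Fin 2))) (c : List (Fin 2) → ℂ), (∀ v ∈ T, v.length ≤ D) ∧
    (∀ B : Fin 2 → Matrix (Fin k) (Fin k) ℂ, (∑ v ∈ T, c v • (v.map B).prod) = 0) ∧ w ∈ T ∧ c w ≠ 0}

/-- The support is a two-sided monoid ideal (`u • f • v ∈ I_k`): a word of the degree-`D` support,
multiplied on both sides, lies in the degree-`D'` support as soon as `|u| + D + |v| ≤ D'` (with a
bihomogeneous witness one may take `D = |w|`, which gives the sharp degree bookkeeping). -/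
theorem idSupport_mul {k D D' : ℕ} {w u v : List (Fin 2)} (hw : w ∈ IdSupport k D)
    (hD : u.length + D + v.length ≤ D') : u ++ w ++ v ∈ IdSupport k D' := by
  classical
  obtain ⟨T, c, hT, hB, hwT, hc⟩ := hw
  let g : List (Fin 2) → List (Fin 2) := fun z => u ++ z ++ v
  let e : List (Fin 2) → List (Fin 2) := fun y =>
    (y.drop u.length).take (y.length - u.length - v.length)
  have heg : ∀ z, e (g z) = z := by
    intro z
    simp only [e, g, List.append_assoc, List.drop_left, List.length_append]
    have : u.length + (z.length + v.length) - u.length - v.length = z.length := by omega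
    rw [this, List.take_left]
  have hinj : Set.InjOn g (T : Set (List (Fin 2))) := by
    intro x _ y _ h
    have := congrArg e h
    rwa [heg, heg] at this
  refine ⟨T.image g, fun y => c (e y), ?_, ?_, Finset.mem_image_of_mem g hwT, ?_⟩
  · intro y hy
    obtain ⟨z, hz, rfl⟩ := Finset.mem_image.1 hy
    simp only [g, List.length_append]
    have := hT z hz
    omega
  · intro B
    rw [Finset.sum_image hinj]
    simp only [heg, g, List.map_append, List.prod_append]
    calc ∑ x ∈ T, c x • ((u.map B).prod * (x.map B).prod * (v.map B).prod)
        = (u.map B).prod * (∑ x ∈ T, c x • (x.map B).prod) * (v.map B).prod := by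
          rw [Finset.mul_sum, Finset.sum_mul]
          exact Finset.sum_congr rfl fun x _ => by rw [Matrix.mul_smul, Matrix.smul_mul]
      _ = 0 := by rw [hB B, Matrix.mul_zero, Matrix.zero_mul]
  · show c (e (g w)) ≠ 0
    rwa [heg]

/-- FIRST LEMMA of the `support-avoidance-automata` card: word-by-word vanishing on the support
gives the window (so for a MONOMIAL pair the window is a pure path-avoidance condition on the
minimal forbidden words). -/
theorem win_of_support_vanishing {n k D : ℕ} (A : Fin 2 → Matrix (Fin n) (Fin n) ℂ)
    (hvan : ∀ w ∈ IdSupport k D, (w.map A).prod = 0) : Win k D A := by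
  intro T c hT hB
  refine Finset.sum_eq_zero fun w hw => ?_
  by_cases hc : c w = 0
  · simp [hc]
  · have hmem : w ∈ IdSupport k D := ⟨T, c, hT, hB, hw, hc⟩
    rw [hvan w hmem, smul_zero]

/-- A `0/1` matrix with at most one nonzero entry in each column (a partial self-map of `Fin n`). -/
def IsPartialMap {n : ℕ} (M : Matrix (Fin n) (Fin n) ℂ) : Prop :=
  (∀ i j, M i j = 0 ∨ M i j = 1) ∧ ∀ j i i', M i j ≠ 0 → M i' j ≠ 0 → i = i'

/-- The finite search target of the card (what the SAT instances decide for each `(n, d)`):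
a MONOMIAL MASQUERADE of `M_k` — a partial-map pair generating in degree `d` whose paths avoid the
support of the identities of degree `≤ 2d`. -/
def MonomialMasquerade (k n d : ℕ) : Prop :=
  ∃ A : Fin 2 → Matrix (Fin n) (Fin n) ℂ, (∀ i, IsPartialMap (A i)) ∧ Gen d A ∧
    ∀ w ∈ IdSupport k (2 * d), (w.map A).prod = 0

/-- Monomial masquerades at every scale for one `k ≥ 2` prove the crux (via
`win_of_support_vanishing`). The card's bet is the existence side; its SAT lane can equally return
the certified negative `¬ MonomialMasquerade 3 n d` for all small `(n,d)`, a data point for item 18945. -/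
theorem longMasquerade_of_monomial
    (h : ∃ k : ℕ, 2 ≤ k ∧ ∀ n₀ : ℕ, ∃ n d : ℕ, n₀ ≤ n ∧ MonomialMasquerade k n d) :
    LongMasquerade := by
  obtain ⟨k, hk, hfam⟩ := h
  refine ⟨k, hk, fun n₀ => ?_⟩
  obtain ⟨n, d, hn, A, -, hgen, hvan⟩ := hfam n₀
  exact ⟨n, d, A, hn, hgen, win_of_support_vanishing A hvan⟩

end Summit.MatrixMultiplication.MatrixMultiplication.Cruxes.LongMasquerade.Ideate2
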